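import Summits.Ventures.HSemireg.WedgeBoxDegreeN

/-!
# Venture HSemireg — the purity locus of the honest box (1/2): corner products and coordinates

HONEST FRAMING. Part of the Lean index of the computation cell `pub-hsemireg` (second enclosure wave, cut by seat p6 in the
conventions of seat p3's ENCLOSURE-PLAN-p3.md / build.py from th-7's kernel assets).  Finite-dimensional exterior algebra over a field ONLY:
no variety, no cohomology theory, no semiregularity map is constructed here; nothing here says that HC / HC_CM / HC_AV holds;
no Literature fact is declared or used.  The geometric DICTIONARY (why these ranks are the `HT`-side box ranks of the cell's
STRUCTURE.md §1 / theory/FORMULA-N.md) lives in theory/FORMULA-N-th7.md PART B §A.3 / §N and is NOT asserted in Lean.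

th-7's PART V — the degree-`n` PURITY LOCUS of the honest box for a GENERAL `2 × 2` coefficient matrix (theory/th7/WeilPurity.lean v3.2 sha256/16 fa4f1543e639b652 (th-7 g5, 22:21Z 2026-08-22; ×2 farm rc 0 + axioms standard at p3 g9 21:58Z (v3.1 prefix), th-2 g22 22:27Z, p6 g7 22:32Z; statement reads + independent exact numerics p6 g6 X2-WEILPURITY-p6g6.md a0873432c5a1b400 (PART W 105/105, PART D 704/704) and p6 g7 X2-WEILPURITY-E-p6g7.md 6348f244af71037e (PART E 216/216)),
l.5360–5652; = theory/th7/PurityRank.lean v1 10469e30f4503d5e section PurityGeneral, ×2 p6 g5 X2-PURITYRANK-p6g5.md: 30/30 exact ranks), VERBATIM up to the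
namespace (`HSemiregBox` ↦ `Summit.Ventures.HSemireg.WedgeBox`; it sits after `WedgeBoxAll.lean`'s `end AllDegrees` in th-7's file), file 1 of 2.
STATEMENT (file 2, `finrank_range_wedgeMap_hbox_degree_n`): for `v = Σ_{α,β} c_{αβ} · E_{A_α} ∧ E_{C_β}` with all four `c_{αβ} ≠ 0`,
`rank(θ ↦ θ ∧ v ∣ ⋀ⁿ K^{4n}) + 4 + 2·[c₀₀c₁₁ = c₀₁c₁₀] = 4·C(2n,n)` (every field, every `n ≥ 1`; `n = 2`: `18 ∣ 20` = `_two_two`) —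
FORMULA-N PART B §L.5 / STRUCTURE C16 (the generic value `4·C(2n,n) − 4` drops by exactly two on the determinant locus).  This file: `hbox`, the triple supports `TA`/`TC`, the unit-twisted coefficients, the four corner products and their coordinates, «only whole blocks reach the triple monomials».
-/

open Module Set Set.powersetCard

namespace Summit.Ventures.HSemireg.WedgeBox

variable (K : Type*) [Field K] {n : ℕ}

/-! ## Part V (th-7 g5, 2026-08-22 evening): the degree-`n` PURITY LOCUS for a GENERAL coefficient matrix.

For the honest box `v = Σ_{α,β} c_{αβ} · E_{A_α} ∧ E_{C_β}` with all four `c_{αβ} ≠ 0` (the model of the Weil-frame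
four-term class `c₁e^{λΘ} + c₂e^{μΘ} + a·vol U₊ + b·vol U₋` in the basis adapted to `(L_λ, L_μ) × (U₊, U₋)`, and of every
`2 × 2`-coefficient combination of the four «corner» pure spinors of a box), the rank of `θ ↦ θ ∧ v` on `⋀^n(K^{4n})` is

  `4·C(2n,n) − 4 − 2·[c₀₀c₁₁ = c₀₁c₁₀]`      (every field, every `n ≥ 1`):

the generic value `4·C(2n,n) − 4` (FORMULA-N PART A §2.7 / PART B §L.5 «+2·[det c ≠ 0]», STRUCTURE C16 purity footnote
`20 ∣ 18`, `76 ∣ 74`, `276 ∣ 274`, …) drops by EXACTLY two on the determinant locus `det c = 0` (= the box / decomposable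
case of Part II's `finrank_range_wedgeMap_fac_mul_degree_n`). Mechanism (PART B §L.5): the two whole `A`-blocks have images
in the plane spanned by the two `A`-side triple monomials, with coordinate rows `(c₁₀, c₁₁)` and `±(c₀₀, c₀₁)`; likewise on the
`C`-side; all other relevant monomials have independent single-pivot images (Part II's `J`-family). Sign-free as everywhere in
this file: only the parity `(−1)^{n·n}` of graded commutativity and the unit-hood of the structure constants are used. -/

section PurityGeneral

variable (n)

/-- the honest box with a general `2 × 2` coefficient matrix: `v = Σ_{α,β} c_{αβ} · E_{A_α} ∧ E_{C_β}`. -/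
noncomputable def hbox (c : Fin 2 → Fin 2 → K) : HT K n :=
  ∑ α, ∑ β, c α β • (B K n (Apc n α : powersetCard (I n) n) * B K n (Cpc n β : powersetCard (I n) n))

/-- the `A`-side triple monomial supports `A₀ ∪ A₁ ∪ C_β`. -/
def TA (β : Fin 2) : Finset (I n) := A n 0 ∪ P n 1 β

/-- the `C`-side triple monomial supports `C₀ ∪ A_α ∪ C₁`. -/
def TC (α : Fin 2) : Finset (I n) := C n 0 ∪ P n α 1

variable {n}

/-- its coefficients in the monomial basis (twisted by the unit structure constants). -/
noncomputable def hboxCoeff (c : Fin 2 → Fin 2 → K) : Fin 2 → Fin 2 → K :=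
  fun α β => c α β * sgn K (Apc n α) (Cpc n β)

/-- the honest box with coefficient matrix `c` is the box class of the unit-twisted coefficients `hboxCoeff c`. -/
lemma hbox_eq_boxClass (c : Fin 2 → Fin 2 → K) : hbox K n c = boxClass K n (hboxCoeff K (n := n) c) := by
  rw [hbox, boxClass]
  refine Finset.sum_congr rfl fun α _ => Finset.sum_congr rfl fun β _ => ?_
  rw [B_mul_B, smul_smul]
  rfl

/-- the unit-twisted coefficients are non-zero when the `c α β` are. -/
lemma hboxCoeff_ne_zero {c : Fin 2 → Fin 2 → K} (hc : ∀ α β, c α β ≠ 0) (α β : Fin 2) :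
    hboxCoeff K (n := n) c α β ≠ 0 :=
  mul_ne_zero (hc α β) ((sgn_ne_zero_iff K).mpr (disjoint_A_C n α β))

/-! #### The four corner products. -/

/-- the `A`-side triple products `E_{A₀} ∧ (E_{A₁} ∧ E_{C_β})`. -/
noncomputable def mA (β : Fin 2) : HT K n :=
  B K n (Apc n 0 : powersetCard (I n) n) *
    (B K n (Apc n 1 : powersetCard (I n) n) * B K n (Cpc n β : powersetCard (I n) n))

/-- the `C`-side triple products `E_{C₀} ∧ (E_{A_α} ∧ E_{C₁})`. -/
noncomputable def mC (α : Fin 2) : HT K n :=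
  B K n (Cpc n 0 : powersetCard (I n) n) *
    (B K n (Apc n α : powersetCard (I n) n) * B K n (Cpc n 1 : powersetCard (I n) n))

/-- the unit in front of the `A`-side triple monomial. -/
noncomputable def uA (β : Fin 2) : K := sgn K (Apc n 1) (Cpc n β) * sgn K (Apc n 0) (Ppc n 1 β)

/-- the unit in front of the `C`-side triple monomial. -/
noncomputable def uC (α : Fin 2) : K := sgn K (Apc n α) (Cpc n 1) * sgn K (Cpc n 0) (Ppc n α 1)

/-- the `A`-side triple product is the unit `uA β` times the monomial `E_{TA β}`. -/
lemma mA_eq (β : Fin 2) : mA K (n := n) β = uA K (n := n) β • B K n (TA n β) := by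
  rw [mA, B_mul_B K (Apc n 1) (Cpc n β), mul_smul_comm,
    show ((Apc n 1 : powersetCard (I n) n).val ∪ (Cpc n β : powersetCard (I n) n).val : Finset (I n)) = P n 1 β from rfl,
    B_mul_BP, smul_smul]
  rfl

/-- the `C`-side triple product is the unit `uC α` times the monomial `E_{TC α}`. -/
lemma mC_eq (α : Fin 2) : mC K (n := n) α = uC K (n := n) α • B K n (TC n α) := by
  rw [mC, B_mul_B K (Apc n α) (Cpc n 1), mul_smul_comm,
    show ((Apc n α : powersetCard (I n) n).val ∪ (Cpc n 1 : powersetCard (I n) n).val : Finset (I n)) = P n α 1 from rfl,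
    B_mul_BP, smul_smul]
  rfl

/-- the unit `uA β` is non-zero. -/
lemma uA_ne_zero (β : Fin 2) : uA K (n := n) β ≠ 0 := by
  refine mul_ne_zero ((sgn_ne_zero_iff K).mpr (disjoint_A_C n 1 β)) ((sgn_ne_zero_iff K).mpr ?_)
  exact (disjoint_P_iff (n := n)).mpr ⟨disjoint_A_A n (by decide), disjoint_A_C n 0 β⟩

/-- the unit `uC α` is non-zero. -/
lemma uC_ne_zero (α : Fin 2) : uC K (n := n) α ≠ 0 := by
  refine mul_ne_zero ((sgn_ne_zero_iff K).mpr (disjoint_A_C n α 1)) ((sgn_ne_zero_iff K).mpr ?_)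
  exact (disjoint_P_iff (n := n)).mpr ⟨(disjoint_A_C n α 0).symm, disjoint_C_C n (by decide)⟩

/-- monomial `E_{A_α}` times the honest box: only the other `A`-block survives. -/
lemma B_A_mul_hbox (hn : 0 < n) (c : Fin 2 → Fin 2 → K) (α : Fin 2) :
    B K n (Apc n α : powersetCard (I n) n) * hbox K n c =
      ∑ β, c (other α) β • (B K n (Apc n α : powersetCard (I n) n) *
        (B K n (Apc n (other α) : powersetCard (I n) n) * B K n (Cpc n β : powersetCard (I n) n))) := by
  rw [hbox, Finset.mul_sum, Finset.sum_eq_single (other α)]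
  · rw [Finset.mul_sum]
    exact Finset.sum_congr rfl fun β _ => mul_smul_comm _ _ _
  · intro α' _ hα'
    have hαα : α' = α := by
      by_contra h; exact hα' (eq_other_of_ne h)
    subst hαα
    rw [Finset.mul_sum]
    refine Finset.sum_eq_zero fun β _ => ?_
    rw [mul_smul_comm, ← mul_assoc, B_mul_B, sgn_of_not_disjoint K, zero_smul, zero_mul, smul_zero]
    rw [coe_Apc, Finset.disjoint_self_iff_empty, ← Finset.card_eq_zero, card_A]
    omega
  · intro h; exact (h (Finset.mem_univ _)).elim

/-- monomial `E_{C_β}` times the honest box: only the other `C`-block survives. -/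
lemma B_C_mul_hbox (hn : 0 < n) (c : Fin 2 → Fin 2 → K) (β : Fin 2) :
    B K n (Cpc n β : powersetCard (I n) n) * hbox K n c =
      ∑ α, c α (other β) • (B K n (Cpc n β : powersetCard (I n) n) *
        (B K n (Apc n α : powersetCard (I n) n) * B K n (Cpc n (other β) : powersetCard (I n) n))) := by
  rw [hbox, Finset.mul_sum]
  refine Finset.sum_congr rfl fun α _ => ?_
  rw [Finset.mul_sum, Finset.sum_eq_single (other β)]
  · rw [mul_smul_comm]
  · intro β' _ hβ'
    have hββ : β' = β := by
      by_contra h; exact hβ' (eq_other_of_ne h)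
    subst hββ
    rw [mul_smul_comm, ← mul_assoc, B_mul_B_comm K (Apc n α) (Cpc n β'), smul_mul_assoc, mul_assoc,
      B_mul_B K (Cpc n β') (Cpc n β'), sgn_of_not_disjoint K, zero_smul, mul_zero, smul_zero, smul_zero]
    rw [coe_Cpc, Finset.disjoint_self_iff_empty, ← Finset.card_eq_zero, card_C]
    omega
  · intro h; exact (h (Finset.mem_univ _)).elim

/-- `E_{A₀} ∧ v = Σ_β c_{1β} · u_β · E_{TA β}`. -/
lemma vA_zero_eq (hn : 0 < n) (c : Fin 2 → Fin 2 → K) :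
    B K n (Apc n 0 : powersetCard (I n) n) * hbox K n c = ∑ β, (c 1 β * uA K (n := n) β) • B K n (TA n β) := by
  rw [B_A_mul_hbox K hn c 0, other_zero]
  refine Finset.sum_congr rfl fun β _ => ?_
  rw [← smul_smul, ← mA_eq]
  rfl

/-- `E_{A₁} ∧ v = Σ_β (−1)^{n·n} c_{0β} · u_β · E_{TA β}`. -/
lemma vA_one_eq (hn : 0 < n) (c : Fin 2 → Fin 2 → K) :
    B K n (Apc n 1 : powersetCard (I n) n) * hbox K n c =
      ∑ β, ((-1 : K) ^ (n * n) * c 0 β * uA K (n := n) β) • B K n (TA n β) := by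
  rw [B_A_mul_hbox K hn c 1, other_one]
  refine Finset.sum_congr rfl fun β _ => ?_
  have h1 : B K n (Apc n 1 : powersetCard (I n) n) *
      (B K n (Apc n 0 : powersetCard (I n) n) * B K n (Cpc n β : powersetCard (I n) n)) =
      ((-1 : K) ^ (n * n)) • mA K (n := n) β := by
    rw [mA, ← mul_assoc, ← mul_assoc, B_mul_B_comm K (Apc n 0) (Apc n 1), smul_mul_assoc]
  rw [h1, mA_eq, smul_smul, smul_smul]
  congr 1
  ring

/-- `E_{C₀} ∧ v = Σ_α c_{α1} · u'_α · E_{TC α}`. -/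
lemma vC_zero_eq (hn : 0 < n) (c : Fin 2 → Fin 2 → K) :
    B K n (Cpc n 0 : powersetCard (I n) n) * hbox K n c = ∑ α, (c α 1 * uC K (n := n) α) • B K n (TC n α) := by
  rw [B_C_mul_hbox K hn c 0, other_zero]
  refine Finset.sum_congr rfl fun α _ => ?_
  rw [← smul_smul, ← mC_eq]
  rfl

/-- `E_{C₁} ∧ v = Σ_α (−1)^{n·n} c_{α0} · u'_α · E_{TC α}`. -/
lemma vC_one_eq (hn : 0 < n) (c : Fin 2 → Fin 2 → K) :
    B K n (Cpc n 1 : powersetCard (I n) n) * hbox K n c =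
      ∑ α, ((-1 : K) ^ (n * n) * c α 0 * uC K (n := n) α) • B K n (TC n α) := by
  rw [B_C_mul_hbox K hn c 1, other_one]
  refine Finset.sum_congr rfl fun α _ => ?_
  have h1 : B K n (Cpc n 1 : powersetCard (I n) n) * B K n (Apc n α : powersetCard (I n) n) =
      ((-1 : K) ^ (n * n)) • (B K n (Apc n α : powersetCard (I n) n) * B K n (Cpc n 1 : powersetCard (I n) n)) :=
    B_mul_B_comm K (Apc n α) (Cpc n 1)
  have h2 : B K n (Cpc n 1 : powersetCard (I n) n) * B K n (Cpc n 0 : powersetCard (I n) n) =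
      ((-1 : K) ^ (n * n)) • (B K n (Cpc n 0 : powersetCard (I n) n) * B K n (Cpc n 1 : powersetCard (I n) n)) :=
    B_mul_B_comm K (Cpc n 0) (Cpc n 1)
  have h3 : B K n (Cpc n 0 : powersetCard (I n) n) * B K n (Apc n α : powersetCard (I n) n) =
      ((-1 : K) ^ (n * n)) • (B K n (Apc n α : powersetCard (I n) n) * B K n (Cpc n 0 : powersetCard (I n) n)) :=
    B_mul_B_comm K (Apc n α) (Cpc n 0)
  have h4 : B K n (Cpc n 1 : powersetCard (I n) n) *
      (B K n (Apc n α : powersetCard (I n) n) * B K n (Cpc n 0 : powersetCard (I n) n)) =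
      ((-1 : K) ^ (n * n)) • mC K (n := n) α := by
    calc B K n (Cpc n 1 : powersetCard (I n) n) *
          (B K n (Apc n α : powersetCard (I n) n) * B K n (Cpc n 0 : powersetCard (I n) n))
        = (B K n (Cpc n 1 : powersetCard (I n) n) * B K n (Apc n α : powersetCard (I n) n)) *
            B K n (Cpc n 0 : powersetCard (I n) n) := (mul_assoc _ _ _).symm
      _ = ((-1 : K) ^ (n * n)) • (B K n (Apc n α : powersetCard (I n) n) *
            (B K n (Cpc n 1 : powersetCard (I n) n) * B K n (Cpc n 0 : powersetCard (I n) n))) := by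
          rw [h1, smul_mul_assoc, mul_assoc]
      _ = ((-1 : K) ^ (n * n)) • (((-1 : K) ^ (n * n)) • (B K n (Apc n α : powersetCard (I n) n) *
            (B K n (Cpc n 0 : powersetCard (I n) n) * B K n (Cpc n 1 : powersetCard (I n) n)))) := by
          rw [h2, mul_smul_comm]
      _ = ((-1 : K) ^ (n * n)) • mC K (n := n) α := by
          rw [mC, ← mul_assoc (B K n (Cpc n 0 : powersetCard (I n) n)), h3, smul_mul_assoc, mul_assoc]
  rw [h4, mC_eq, smul_smul, smul_smul]
  congr 1
  ring

/-! #### The four triple monomials are distinct. -/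

/-- the two `A`-side triple supports differ (`n > 0`). -/
lemma TA_zero_ne_TA_one (hn : 0 < n) : TA n 0 ≠ TA n 1 := by
  intro h
  obtain ⟨i, hi⟩ : (C n 0).Nonempty := by rw [← Finset.card_pos, card_C]; exact hn
  have : i ∈ TA n 1 := by
    rw [← h, TA, P]; exact Finset.mem_union_right _ (Finset.mem_union_right _ hi)
  rw [TA, P, Finset.mem_union, Finset.mem_union] at this
  rcases this with h1 | h2 | h3
  · exact Finset.disjoint_left.mp (disjoint_A_C n 0 0) h1 hi
  · exact Finset.disjoint_left.mp (disjoint_A_C n 1 0) h2 hi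
  · exact Finset.disjoint_left.mp (disjoint_C_C n (show (0 : Fin 2) ≠ 1 by decide)) hi h3

/-- the two `C`-side triple supports differ (`n > 0`). -/
lemma TC_zero_ne_TC_one (hn : 0 < n) : TC n 0 ≠ TC n 1 := by
  intro h
  obtain ⟨i, hi⟩ : (A n 1).Nonempty := by rw [← Finset.card_pos, card_A]; exact hn
  have : i ∈ TC n 0 := by
    rw [h, TC, P]; exact Finset.mem_union_right _ (Finset.mem_union_left _ hi)
  rw [TC, P, Finset.mem_union, Finset.mem_union] at this
  rcases this with h1 | h2 | h3
  · exact Finset.disjoint_left.mp (disjoint_A_C n 1 0) hi h1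
  · exact Finset.disjoint_left.mp (disjoint_A_A n (show (1 : Fin 2) ≠ 0 by decide)) hi h2
  · exact Finset.disjoint_left.mp (disjoint_A_C n 1 1) hi h3

/-- an `A`-side triple support is never a `C`-side one (`n > 0`). -/
lemma TA_ne_TC (hn : 0 < n) (α β : Fin 2) : TA n β ≠ TC n α := by
  intro h
  obtain ⟨i, hi⟩ : (A n (other α)).Nonempty := by rw [← Finset.card_pos, card_A]; exact hn
  have hiTA : i ∈ TA n β := by
    rw [TA, P, Finset.mem_union, Finset.mem_union]
    by_cases hα : α = 0
    · subst hα; rw [other_zero] at hi; exact Or.inr (Or.inl hi)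
    · have hα1 : α = 1 := by omega
      subst hα1; rw [other_one] at hi; exact Or.inl hi
  rw [h, TC, P, Finset.mem_union, Finset.mem_union] at hiTA
  rcases hiTA with h1 | h2 | h3
  · exact Finset.disjoint_left.mp (disjoint_A_C n (other α) 0) hi h1
  · exact Finset.disjoint_left.mp (disjoint_A_A n (other_ne α)) hi h2
  · exact Finset.disjoint_left.mp (disjoint_A_C n (other α) 1) hi h3

/-! #### Coordinates. -/

/-- coordinates of a basis monomial: `coord_t (E_s) = [s = t]`. -/
lemma coord_B (t s : Finset (I n)) : (B K n).coord t (B K n s) = if s = t then 1 else 0 := by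
  classical
  rw [Basis.coord_apply, Basis.repr_self, Finsupp.single_apply]

/-- coordinate of a two-term combination `Σ_β d_β E_{T β}` at `t`. -/
lemma coord_sum_two (t : Finset (I n)) (d : Fin 2 → K) (T : Fin 2 → Finset (I n)) :
    (B K n).coord t (∑ β, d β • B K n (T β)) =
      d 0 * (if T 0 = t then 1 else 0) + d 1 * (if T 1 = t then 1 else 0) := by
  rw [Fin.sum_univ_two, map_add, map_smul, map_smul, coord_B, coord_B, smul_eq_mul, smul_eq_mul]

/-- the `TA β`-coordinate of `Σ_{β'} d_{β'} E_{TA β'}` is `d β` (`n > 0`). -/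
lemma coord_TA_sum_TA (hn : 0 < n) (d : Fin 2 → K) (β : Fin 2) :
    (B K n).coord (TA n β) (∑ β', d β' • B K n (TA n β')) = d β := by
  rw [coord_sum_two]
  by_cases hβ : β = 0
  · subst hβ
    rw [if_pos rfl, if_neg (TA_zero_ne_TA_one hn).symm, mul_one, mul_zero, add_zero]
  · have hβ1 : β = 1 := by omega
    subst hβ1
    rw [if_neg (TA_zero_ne_TA_one hn), if_pos rfl, mul_zero, mul_one, zero_add]

/-- the `TC α`-coordinate of `Σ_{β'} d_{β'} E_{TA β'}` vanishes (`n > 0`). -/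
lemma coord_TC_sum_TA (hn : 0 < n) (d : Fin 2 → K) (α : Fin 2) :
    (B K n).coord (TC n α) (∑ β', d β' • B K n (TA n β')) = 0 := by
  rw [coord_sum_two, if_neg (TA_ne_TC hn α 0), if_neg (TA_ne_TC hn α 1), mul_zero, mul_zero, add_zero]

/-- the `TC α`-coordinate of `Σ_{α'} d_{α'} E_{TC α'}` is `d α` (`n > 0`). -/
lemma coord_TC_sum_TC (hn : 0 < n) (d : Fin 2 → K) (α : Fin 2) :
    (B K n).coord (TC n α) (∑ α', d α' • B K n (TC n α')) = d α := by
  rw [coord_sum_two]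
  by_cases hα : α = 0
  · subst hα
    rw [if_pos rfl, if_neg (TC_zero_ne_TC_one hn).symm, mul_one, mul_zero, add_zero]
  · have hα1 : α = 1 := by omega
    subst hα1
    rw [if_neg (TC_zero_ne_TC_one hn), if_pos rfl, mul_zero, mul_one, zero_add]

/-! #### Only whole blocks reach the triple monomials. -/

/-- every `A`-block lies in `TA β`. -/
lemma A_subset_TA (γ β : Fin 2) : A n γ ⊆ TA n β := by
  intro i hi
  rw [TA, P, Finset.mem_union, Finset.mem_union]
  by_cases hγ : γ = 0
  · subst hγ; exact Or.inl hi
  · have hγ1 : γ = 1 := by omega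
    subst hγ1; exact Or.inr (Or.inl hi)

/-- every `C`-block lies in `TC α`. -/
lemma C_subset_TC (δ α : Fin 2) : C n δ ⊆ TC n α := by
  intro i hi
  rw [TC, P, Finset.mem_union, Finset.mem_union]
  by_cases hδ : δ = 0
  · subst hδ; exact Or.inl hi
  · have hδ1 : δ = 1 := by omega
    subst hδ1; exact Or.inr (Or.inr hi)

/-- if `s ∪ P α' β' = TA β` with `card s = n`, then `s` is the OTHER `A`-block. -/
lemma eq_A_of_union_eq_TA {s : Finset (I n)} {α' β' β : Fin 2} (hs : s.card = n)
    (h : s ∪ P n α' β' = TA n β) : s = A n (other α') := by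
  have hsub : A n (other α') ⊆ s ∪ P n α' β' := by rw [h]; exact A_subset_TA _ _
  have hsub' := A_subset_of_subset_union (other_ne α') hsub
  exact (Finset.eq_of_subset_of_card_le hsub' (by rw [card_A, hs])).symm

/-- if `s ∪ P α' β' = TC α` with `card s = n`, then `s` is the OTHER `C`-block. -/
lemma eq_C_of_union_eq_TC {s : Finset (I n)} {α' β' α : Fin 2} (hs : s.card = n)
    (h : s ∪ P n α' β' = TC n α) : s = C n (other β') := by
  have hsub : C n (other β') ⊆ s ∪ P n α' β' := by rw [h]; exact C_subset_TC _ _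
  have hsub' := C_subset_of_subset_union (other_ne β') hsub
  exact (Finset.eq_of_subset_of_card_le hsub' (by rw [card_C, hs])).symm

end PurityGeneral

end Summit.Ventures.HSemireg.WedgeBox
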